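import Mathlib.Algebra.Order.Floor.Ring
import Mathlib.Data.Rat.Floor
import Mathlib.Data.ZMod.Basic
import Mathlib.Data.Finset.Basic
import Mathlib.LinearAlgebra.FiniteDimensional.Lemmas
import Mathlib.Tactic.Linarith
import Mathlib.Tactic.Ring
import Mathlib.Tactic.FieldSimp
import HarnessLib

/-!
# The Prym–Torelli rank of the Galois–Prym habitat families: arithmetic and linear-algebra skeleton (WEIL-2 gen 42, PRYM-G42, fact-free)

research route, not a corollary; conditional on HC_CM plus one named minimal statement.

Cell `pub-hodge-ring2-ab-*` (ALL ABELIAN VARIETIES), seat WEIL-2 gen 42, account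
`run/shared/lean/pub/pub-hodge-ring2/pub-hodge-ring2-ab-weil-2/PRYM-G42.md`.

Informal setting (PRYM-G42 §1).  For a `G`-curve `C`, `G = ℤ/f ⋊ H`, with Kummer presentation `ℂ(C) = ℂ(C')(z)`, `z^f = F`,
`Δ = div F` on `C' = C/N`, the two multiplicity spaces of the `K`-piece are `V_{±Δ} = L(K' + ⌈±Δ/f⌉)` and the codifferential
of its period map on the `G`-Hurwitz family is `h ⊗ h' ↦ Tr_H(h h')` into `L(2K' + B')^H` (THEOREM PT).  This file kernel-checks
the bookkeeping used there:
* `ceil_add_ceil_neg_of_dvd` / `_of_not_dvd`: `⌈v/f⌉ + ⌈−v/f⌉ = [f ∤ v]`, i.e. `⌈Δ/f⌉ + ⌈−Δ/f⌉ = B'` coefficientwise (§1.2);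
* `image_add_range_prod_range`: `{i + j : i < d, j < d'} = {0,…,d+d'−2}` for `d, d' ≥ 1` — the combinatorial core of COROLLARY C
  (cyclic covers of `ℙ¹`: the eigen-piece period map is an immersion at every member, §2.1);
* `finrank_map_add_finrank_inf_ker`: for a linear endomorphism `T` and a subspace `U`, `dim T(U) + dim (U ∩ ker T) = dim U` — with
  `T = 1 + ι` this is the trace-rank formula `rank μ = dim(V·V') − dim(V·V' ∩ anti-invariants)` of §3.2;
* `residues_pair_surjective`: every `N`-type residue pair `(c, 5c) mod 12` is of the form `(k + 5k' + 3m, k' + 5k + 3m)` (§3.1, the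
  construction of members from functions `F₀ (ι^*F₀)^5 g(x)^3`), and `hres_five` / `hres_seven`: the `H`-type residues
  `a(1+h) mod 12` lie in `{0,6}` (`h = 5`) resp. `{0,4,8}` (`h = 7`).

0 sorry, no `def`, no named fact; `HC_CM` does not occur.
-/

namespace Summit.HodgeConjecture.Ring2AbelianAll.PrymTorelliRank

section ceil

/-- `⌈a⌉ + ⌈-a⌉ = 0` when `a` is an integer (cast to `ℚ`).  [PRYM-G42 §1.2]
research route, not a corollary; conditional on HC_CM plus one named minimal statement. -/
theorem ceil_add_ceil_neg_int (n : ℤ) : ⌈(n : ℚ)⌉ + ⌈(-(n : ℚ))⌉ = 0 := by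
  rw [Int.ceil_intCast, ← Int.cast_neg, Int.ceil_intCast]; ring

/-- `⌈a⌉ + ⌈-a⌉ = 1` when `a ∈ ℚ` is not an integer.  [PRYM-G42 §1.2]
research route, not a corollary; conditional on HC_CM plus one named minimal statement. -/
theorem ceil_add_ceil_neg_of_ne_floor (a : ℚ) (h : (⌊a⌋ : ℚ) ≠ a) : ⌈a⌉ + ⌈-a⌉ = 1 := by
  rw [Int.ceil_neg]
  have h1 : (⌊a⌋ : ℚ) < a := lt_of_le_of_ne (Int.floor_le a) h
  have h2 : ⌈a⌉ = ⌊a⌋ + 1 := by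
    rw [Int.ceil_eq_iff]
    constructor
    · push_cast; linarith
    · push_cast; have := Int.lt_floor_add_one a; linarith
  omega

/-- Divisible case of the coefficient identity `⌈v/f⌉ + ⌈-v/f⌉ = [f ∤ v]`: if `f ∣ v` the sum is `0`.  [PRYM-G42 §1.2]
research route, not a corollary; conditional on HC_CM plus one named minimal statement. -/
theorem ceil_add_ceil_neg_of_dvd {f v : ℤ} (hf : f ≠ 0) (h : f ∣ v) :
    ⌈(v : ℚ) / f⌉ + ⌈-((v : ℚ) / f)⌉ = 0 := by
  obtain ⟨k, rfl⟩ := h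
  have hf' : (f : ℚ) ≠ 0 := by exact_mod_cast hf
  have : ((f * k : ℤ) : ℚ) / f = (k : ℚ) := by push_cast; field_simp
  rw [this]
  exact ceil_add_ceil_neg_int k

/-- Non-divisible case of the coefficient identity: if `f ∤ v` then `⌈v/f⌉ + ⌈-v/f⌉ = 1`; with `v = v_q(Δ)` this says that the
coefficient of `q` in `⌈Δ/f⌉ + ⌈−Δ/f⌉` is `1` exactly at the branch places `q ∈ B'`.  [PRYM-G42 §1.2]
research route, not a corollary; conditional on HC_CM plus one named minimal statement. -/
theorem ceil_add_ceil_neg_of_not_dvd {f v : ℤ} (hf : f ≠ 0) (h : ¬ f ∣ v) :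
    ⌈(v : ℚ) / f⌉ + ⌈-((v : ℚ) / f)⌉ = 1 := by
  apply ceil_add_ceil_neg_of_ne_floor
  intro hfl
  apply h
  have hf' : (f : ℚ) ≠ 0 := by exact_mod_cast hf
  refine ⟨⌊(v : ℚ) / f⌋, ?_⟩
  have : (v : ℚ) = f * ⌊(v : ℚ) / f⌋ := by rw [hfl]; field_simp
  exact_mod_cast this

end ceil

section sumset

open Finset

/-- **Sumset of two intervals** (core of COROLLARY C, PRYM-G42 §2.1): for `d, d' ≥ 1` the sums `i + j` with `i < d`, `j < d'` are
exactly the integers `< d + d' - 1`.  For a cyclic cover of `ℙ¹` the products of the eigenforms `x^i ∏(x−a_k)^{-1} dx`-type bases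
therefore span ALL polynomials of degree `≤ d + d' − 2 = r − 4`, i.e. the codifferential is surjective at every member.
research route, not a corollary; conditional on HC_CM plus one named minimal statement. -/
theorem image_add_range_prod_range {d d' : ℕ} (hd : 1 ≤ d) (hd' : 1 ≤ d') :
    ((range d) ×ˢ (range d')).image (fun p => p.1 + p.2) = range (d + d' - 1) := by
  ext x
  simp only [mem_image, mem_product, mem_range, Prod.exists]
  constructor
  · rintro ⟨i, j, ⟨hi, hj⟩, rfl⟩
    omega
  · intro hx
    refine ⟨min x (d - 1), x - min x (d - 1), ⟨?_, ?_⟩, ?_⟩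
    · omega
    · omega
    · omega

/-- Consequently the number of distinct sums is `d + d' − 1` (the rank in COROLLARY C is `min(r−3, ·)` with `d + d' − 1 = r − 3`).
research route, not a corollary; conditional on HC_CM plus one named minimal statement. -/
theorem card_image_add_range_prod_range {d d' : ℕ} (hd : 1 ≤ d) (hd' : 1 ≤ d') :
    (((range d) ×ˢ (range d')).image (fun p => p.1 + p.2)).card = d + d' - 1 := by
  rw [image_add_range_prod_range hd hd', card_range]

end sumset

section tracerank

open Module

variable {F : Type*} [Field F] {W : Type*} [AddCommGroup W] [Module F W] [FiniteDimensional F W]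

/-- **Trace-rank formula** (PRYM-G42 §3.2): for a linear map `T : W → W` and a subspace `U`,
`dim T(U) + dim (ker T restricted to U) = dim U`.  Applied to `T = 1 + ι` (`ι` the hyperelliptic involution acting on
`L(2K'+B')`) and `U =` the span of the products `V_Δ · V_{−Δ}`: the rank of the codifferential equals `dim U` minus the dimension
of the `ι`-anti-invariant elements of `U`.
research route, not a corollary; conditional on HC_CM plus one named minimal statement. -/
theorem finrank_map_add_finrank_ker_restrict (T : W →ₗ[F] W) (U : Submodule F W) :
    finrank F (U.map T) + finrank F (LinearMap.ker (T.domRestrict U)) = finrank F U := by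
  have h := LinearMap.finrank_range_add_finrank_ker (T.domRestrict U)
  rw [LinearMap.range_domRestrict] at h
  exact h

omit [FiniteDimensional F W] in
/-- The kernel of the restriction is `U ∩ ker T` pulled back to `U`.  [PRYM-G42 §3.2]
research route, not a corollary; conditional on HC_CM plus one named minimal statement. -/
theorem ker_domRestrict_eq (T : W →ₗ[F] W) (U : Submodule F W) :
    LinearMap.ker (T.domRestrict U) = (LinearMap.ker T).comap U.subtype := by
  rw [LinearMap.ker_domRestrict]

end tracerank

section residues

/-- `H`-type residues for `h = 5` (`K = ℚ(i)`): `a(1+h) = 6a ≡ 0` or `6 (mod 12)` — the Weierstrass points of `C'` are unramified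
or of index 2 in `C → C'`.  [PRYM-G42 §3.1]
research route, not a corollary; conditional on HC_CM plus one named minimal statement. -/
theorem hres_five (a : ZMod 12) : a * (1 + 5) = 0 ∨ a * (1 + 5) = 6 := by
  revert a; decide

/-- `H`-type residues for `h = 7` (`K = ℚ(√−3)`): `a(1+h) = 8a ∈ {0, 4, 8} (mod 12)` — unramified or of index 3.  [PRYM-G42 §3.1]
research route, not a corollary; conditional on HC_CM plus one named minimal statement. -/
theorem hres_seven (a : ZMod 12) : a * (1 + 7) = 0 ∨ a * (1 + 7) = 4 ∨ a * (1 + 7) = 8 := by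
  revert a; decide

/-- `5` and `7` are involutions of `ℤ/12` (`h² = 1`), so `v_{ιq} ≡ h·v_q` is consistent with `ι² = 1`.  [PRYM-G42 §3.1]
research route, not a corollary; conditional on HC_CM plus one named minimal statement. -/
theorem five_sq_seven_sq : (5 : ZMod 12) * 5 = 1 ∧ (7 : ZMod 12) * 7 = 1 := by decide

/-- **Every `N`-type residue pair is constructible** (`h = 5`): for each `c ∈ ℤ/12` the pair `(c, 5c)` equals
`(k + 5k' + 3m, k' + 5k + 3m)` for some `k, k' ∈ {0,1}` (simple zeros of `F₀` at `P`, `ιP`) and `m` (a cube `u_P(x)^{3m}`):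
witnesses tabulated and checked.  [PRYM-G42 §3.1]
research route, not a corollary; conditional on HC_CM plus one named minimal statement. -/
theorem residues_pair_surjective (c : ZMod 12) :
    ∃ k k' m : ZMod 12, (k = 0 ∨ k = 1) ∧ (k' = 0 ∨ k' = 1) ∧ k + 5 * k' + 3 * m = c ∧ k' + 5 * k + 3 * m = 5 * c := by
  revert c; decide

/-- The `G`-structure condition on `Δ = δ₀ − 12 D₀` for `h = 5` reads `6[D₀] = −[T₀]` because `[ι D₀] = −[D₀]` on `Pic⁰` of a
hyperelliptic curve: the coefficient `−(−1) + 5 = 6`; for `h = 7` it is `8`, and `gcd(8, 12) = 4`.  [PRYM-G42 §3.1]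
research route, not a corollary; conditional on HC_CM plus one named minimal statement. -/
theorem torsor_orders : (-(-1 : ℤ) + 5 = 6) ∧ (-(-1 : ℤ) + 7 = 8) ∧ Int.gcd 8 12 = 4 ∧ Int.gcd 6 12 = 6 := by decide

end residues

end Summit.HodgeConjecture.Ring2AbelianAll.PrymTorelliRank
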